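import Summits.HubbardSuperconductivity.HubbardSuperconductivity.Theorems.JosephsonMirrorMirrorSymmetry

/-!
# Route `JosephsonMirror` — the column pigeonhole on a Hermitian window matrix

Helper file for the crux stmt-HubbardSuperconductivity-2227 (`JmInterchange`) of route
`JosephsonMirror` (sub-problem `HubbardSuperconductivity`), line `Sketch`, stub
`stub_windowPigeonhole`: the abstract finite-dimensional pigeonhole `windowPigeonhole`.

In Lieb's packaging `ψ_W (s,t) = W s t` of a Hermitian window matrix `W` (unit vector, supported
on pairs in a common block `P₁` or `P₂`), with `A ≥ e₀` on block-supported vectors and the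
one-layer bounds `‖D v‖², ‖Dᴴ v‖² ≤ M ‖v‖²`:

* the columns `w_t = W · e_t` are block-supported and `Σ_t ‖w_t‖² = 1`;
* `Re ⟨ψ_W, (A ⊗ 1 + 1 ⊗ Aᵀ) ψ_W⟩ = 2 Σ_t Re ⟨w_t, A w_t⟩` (`re_star_vec_double_mulVec_vec`);
* `⟨ψ_W, (D ⊗ D̄) ψ_W⟩ = Tr (Wᴴ D W Dᴴ) = ⟨Dᴴ W, W Dᴴ⟩_HS` and the Hilbert–Schmidt AM–GM
  inequality `2 Re ⟨X, Y⟩_HS ≤ λ ‖X‖² + λ⁻¹ ‖Y‖²` give `Σ_t ‖D w_t‖² ≥ κ² / (4M)` whenever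
  `κ ≤ Re ⟨ψ_W, (D ⊗ D̄ + Dᴴ ⊗ D̄ᴴ) ψ_W⟩`;
* a Markov / reverse-Markov pigeonhole over the finite law `‖w_t‖²` (`exists_good_index`) then
  produces ONE column with `‖D w_t‖² ≥ κ²/(8M) ‖w_t‖²` and `A`-excess `≤ 8 M² η / κ² · ‖w_t‖²`.

Sources: E. H. Lieb, Phys. Rev. Lett. 62 (1989) 1201 (the `W`-matrix packaging); T. Koma,
H. Tasaki, J. Stat. Phys. 76 (1994) 745. All statements are folklore linear algebra.
No new definitions.
-/

-- the mandated namespace `Summit.<Summit>.<Problem>.Theorems` repeats `HubbardSuperconductivity`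
-- (single-problem summit, D-0017), which the `dupNamespace` linter flags on every declaration
set_option linter.dupNamespace false

namespace Summit.HubbardSuperconductivity.HubbardSuperconductivity.Theorems.JosephsonMirror

open Matrix Literature.MathematicalPhysics.QuantumLattice
open scoped Kronecker ComplexOrder

section RealPigeonhole

/-- **Markov / reverse-Markov pigeonhole over a finite law.** If `p ≥ 0` sums to `1`,
`g ≤ M p` pointwise with `Σ g ≥ β > 0`, and `exc ≥ 0` with `Σ exc ≤ η / 2`, then some index
carries positive mass, `g ≥ (β/2) p` and `exc ≤ (2Mη/β) p`. (The indices with `g < (β/2) p` carry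
at most `β/2` of `Σ g`, so the others have mass `≥ β/(2M)`; the indices with `exc > (2Mη/β) p`
have mass `≤ β/(4M)`.) [folklore] -/
theorem exists_good_index {ι : Type*} [Fintype ι] (p g exc : ι → ℝ) {M β η : ℝ} (hM : 0 < M)
    (hβ : 0 < β) (hη : 0 ≤ η) (hp : ∀ t, 0 ≤ p t) (hp1 : ∑ t, p t = 1)
    (hg : ∀ t, g t ≤ M * p t) (hgs : β ≤ ∑ t, g t) (hexc : ∀ t, 0 ≤ exc t)
    (hexcs : ∑ t, exc t ≤ η / 2) :
    ∃ t, 0 < p t ∧ β / 2 * p t ≤ g t ∧ exc t ≤ 2 * M * η / β * p t := by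
  set q : ℝ := β / (2 * M) with hq
  have hq0 : 0 < q := div_pos hβ (by positivity)
  have hC : 2 * M * η / β = η / q := by
    rw [hq]
    field_simp
  -- reverse Markov: the indices with `g ≥ (β/2) p` have mass `≥ q`
  have h1 : q ≤ ∑ t, (if β / 2 * p t ≤ g t then p t else 0) := by
    have hle : ∀ t, g t ≤ β / 2 * p t + M * (if β / 2 * p t ≤ g t then p t else 0) := by
      intro t
      split_ifs with h
      · nlinarith [hg t, hp t, hβ]
      · push Not at h
        rw [mul_zero, add_zero]
        exact h.le
    have hsum : β ≤ β / 2 + M * ∑ t, (if β / 2 * p t ≤ g t then p t else 0) := by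
      calc β ≤ ∑ t, g t := hgs
        _ ≤ ∑ t, (β / 2 * p t + M * (if β / 2 * p t ≤ g t then p t else 0)) :=
            Finset.sum_le_sum fun t _ => hle t
        _ = β / 2 * ∑ t, p t + M * ∑ t, (if β / 2 * p t ≤ g t then p t else 0) := by
            rw [Finset.sum_add_distrib, Finset.mul_sum, Finset.mul_sum]
        _ = β / 2 + M * ∑ t, (if β / 2 * p t ≤ g t then p t else 0) := by rw [hp1, mul_one]
    rw [hq, div_le_iff₀ (by positivity)]
    nlinarith
  -- Markov: the indices with `exc > (η/q) p` have mass `≤ q/2`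
  have h2 : ∑ t, (if η / q * p t < exc t then p t else 0) ≤ q / 2 := by
    rcases hη.eq_or_lt with h0 | hpos
    · have hz : ∀ t, exc t = 0 := by
        intro t
        have := Finset.single_le_sum (fun t _ => hexc t) (Finset.mem_univ t) (f := exc)
        linarith [hexc t]
      have hno : ∀ t, ¬ (η / q * p t < exc t) := by
        intro t
        rw [← h0, zero_div, zero_mul, hz t]
        exact lt_irrefl 0
      simp only [hno, if_false, Finset.sum_const_zero]
      positivity
    · have hle : ∀ t, (if η / q * p t < exc t then p t else 0) ≤ q / η * exc t := by
        intro t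
        split_ifs with h
        · rw [div_mul_eq_mul_div, div_lt_iff₀ hq0] at h
          rw [div_mul_eq_mul_div, le_div_iff₀ hpos]
          linarith
        · exact mul_nonneg (div_nonneg hq0.le hpos.le) (hexc t)
      calc ∑ t, (if η / q * p t < exc t then p t else 0) ≤ ∑ t, q / η * exc t :=
            Finset.sum_le_sum fun t _ => hle t
        _ = q / η * ∑ t, exc t := by rw [Finset.mul_sum]
        _ ≤ q / η * (η / 2) := mul_le_mul_of_nonneg_left hexcs (by positivity)
        _ = q / 2 := by
            field_simp
  -- hence the doubly good indices have mass `≥ q/2 > 0`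
  have h3 : q / 2 ≤ ∑ t, (if β / 2 * p t ≤ g t ∧ ¬ (η / q * p t < exc t) then p t else 0) := by
    have hle : ∀ t, (if β / 2 * p t ≤ g t then p t else 0) ≤
        (if β / 2 * p t ≤ g t ∧ ¬ (η / q * p t < exc t) then p t else 0) +
          (if η / q * p t < exc t then p t else 0) := by
      intro t
      by_cases ha : β / 2 * p t ≤ g t <;> by_cases hb : η / q * p t < exc t <;>
        simp [ha, hb, hp t]
    have h := Finset.sum_le_sum fun t (_ : t ∈ Finset.univ) => hle t
    rw [Finset.sum_add_distrib] at h
    linarith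
  by_contra hne
  push Not at hne
  have h4 : ∑ t, (if β / 2 * p t ≤ g t ∧ ¬ (η / q * p t < exc t) then p t else 0) ≤ 0 := by
    refine Finset.sum_nonpos fun t _ => ?_
    split_ifs with h
    · by_contra hpt
      push Not at hpt
      refine h.2 ?_
      have := hne t hpt h.1
      rwa [hC] at this
    · exact le_rfl
  linarith

end RealPigeonhole

section Abstract

variable {ι : Type*} [Fintype ι] [DecidableEq ι]

omit [DecidableEq ι] in
/-- **Hilbert–Schmidt AM–GM**: `2 Re ⟨X, Y⟩_HS ≤ λ ‖X‖²_HS + λ⁻¹ ‖Y‖²_HS` for `λ > 0`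
(expand `0 ≤ ‖λ X - Y‖²_HS`). [folklore] -/
theorem two_mul_re_hsInner_le (X Y : Matrix ι ι ℂ) {l : ℝ} (hl : 0 < l) :
    2 * (hsInner X Y).re ≤ l * (hsInner X X).re + l⁻¹ * (hsInner Y Y).re := by
  have h0 := hsInner_self_re_nonneg ((l : ℂ) • X - Y)
  simp only [hsInner_sub_left, hsInner_sub_right, hsInner_smul_left, hsInner_smul_right,
    Complex.star_def, Complex.conj_ofReal, Complex.sub_re, Complex.re_ofReal_mul] at h0
  have hYX : (hsInner Y X).re = (hsInner X Y).re := by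
    rw [← star_hsInner X Y, Complex.star_def, Complex.conj_re]
  rw [hYX] at h0
  have key : 0 ≤ l ^ 2 * (hsInner X X).re - 2 * l * (hsInner X Y).re + (hsInner Y Y).re := by
    nlinarith [h0]
  rw [← sub_nonneg]
  have hrw : l * (hsInner X X).re + l⁻¹ * (hsInner Y Y).re - 2 * (hsInner X Y).re =
      l⁻¹ * (l ^ 2 * (hsInner X X).re - 2 * l * (hsInner X Y).re + (hsInner Y Y).re) := by
    field_simp
    ring
  rw [hrw]
  exact mul_nonneg (inv_nonneg.2 hl.le) key

omit [DecidableEq ι] in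
/-- `⟨W, X W Xᴴ⟩_HS = ⟨Xᴴ W, W Xᴴ⟩_HS` (`Tr (Wᴴ X W Xᴴ)` both ways). [folklore] -/
theorem hsInner_conj_eq (W X : Matrix ι ι ℂ) :
    hsInner W (X * W * Xᴴ) = hsInner (Xᴴ * W) (W * Xᴴ) := by
  simp only [hsInner, conjTranspose_mul, conjTranspose_conjTranspose, Matrix.mul_assoc]

omit [DecidableEq ι] in
/-- For Hermitian `W`: `‖W Xᴴ‖²_HS = ‖X W‖²_HS` (`(W Xᴴ)ᴴ = X W` and cyclicity of the trace).
[folklore] -/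
theorem hsInner_mul_conjTranspose_self {W : Matrix ι ι ℂ} (hW : Wᴴ = W) (X : Matrix ι ι ℂ) :
    hsInner (W * Xᴴ) (W * Xᴴ) = hsInner (X * W) (X * W) := by
  simp only [hsInner, conjTranspose_mul, conjTranspose_conjTranspose, hW]
  rw [trace_mul_comm]

omit [DecidableEq ι] in
/-- `‖X W‖²_HS = Σ_t ‖X w_t‖²` over the columns `w_t = W · e_t`. [folklore] -/
theorem hsInner_mul_self_eq_sum_cols (X W : Matrix ι ι ℂ) :
    hsInner (X * W) (X * W) = ∑ t, star (X *ᵥ fun s => W s t) ⬝ᵥ (X *ᵥ fun s => W s t) := by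
  rw [hsInner_apply, Finset.sum_comm]
  rfl

omit [DecidableEq ι] in
/-- `‖ψ_W‖² = Σ_t ‖w_t‖²` over the columns `w_t = W · e_t` of the packaged matrix. [folklore] -/
theorem star_vec_self_eq_sum_cols (W : Matrix ι ι ℂ) :
    star (fun p : ι × ι => W p.1 p.2) ⬝ᵥ (fun p : ι × ι => W p.1 p.2) =
      ∑ t, star (fun s => W s t) ⬝ᵥ fun s => W s t :=
  star_dotProduct_self_eq_sum_cols _

/-- The decoupled double on a packaged Hermitian matrix, columnwise:
`Re ⟨ψ_W, (A ⊗ 1 + 1 ⊗ Aᵀ) ψ_W⟩ = 2 Σ_t Re ⟨w_t, A w_t⟩` (the rows of a Hermitian `W` are the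
conjugates of its columns, and `⟨ū, Aᵀ ū⟩ = ⟨u, A u⟩`). [folklore] -/
theorem re_star_vec_double_mulVec_vec (A : Matrix ι ι ℂ) {W : Matrix ι ι ℂ} (hW : Wᴴ = W) :
    (star (fun p : ι × ι => W p.1 p.2) ⬝ᵥ
        (A ⊗ₖ (1 : Matrix ι ι ℂ) + (1 : Matrix ι ι ℂ) ⊗ₖ Aᵀ) *ᵥ (fun p : ι × ι => W p.1 p.2)).re =
      2 * ∑ t, (star (fun s => W s t) ⬝ᵥ A *ᵥ fun s => W s t).re := by
  have hc : star (fun p : ι × ι => W p.1 p.2) ⬝ᵥ (A ⊗ₖ (1 : Matrix ι ι ℂ)) *ᵥ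
      (fun p : ι × ι => W p.1 p.2) = ∑ t, star (fun s => W s t) ⬝ᵥ A *ᵥ fun s => W s t :=
    star_dotProduct_kronecker_one_mulVec A _
  have hr : star (fun p : ι × ι => W p.1 p.2) ⬝ᵥ ((1 : Matrix ι ι ℂ) ⊗ₖ Aᵀ) *ᵥ
      (fun p : ι × ι => W p.1 p.2) = ∑ s, star (fun t => W s t) ⬝ᵥ Aᵀ *ᵥ fun t => W s t :=
    star_dotProduct_one_kronecker_mulVec Aᵀ _
  have hrow : ∀ s, star (fun t => W s t) = fun t => W t s := by
    intro s
    funext t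
    rw [Pi.star_apply, ← conjTranspose_apply, hW]
  rw [add_mulVec, dotProduct_add, Complex.add_re, hc, hr, two_mul, Complex.re_sum, Complex.re_sum]
  congr 1
  refine Finset.sum_congr rfl fun s _ => ?_
  rw [star_dotProduct_transpose_mulVec, hrow s]

omit [DecidableEq ι] in
/-- The Josephson coupling on a packaged matrix:
`⟨ψ_W, (D ⊗ D̄ + Dᴴ ⊗ D̄ᴴ) ψ_W⟩ = ⟨W, D W Dᴴ⟩_HS + ⟨W, Dᴴ W D⟩_HS` (`D̄ = Dᴴᵀ`). Lieb, PRL 62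
(1989) 1201, eq. (4). [folklore] -/
theorem star_vec_coupling_mulVec_vec (D W : Matrix ι ι ℂ) :
    star (fun p : ι × ι => W p.1 p.2) ⬝ᵥ (D ⊗ₖ Dᴴᵀ + Dᴴ ⊗ₖ Dᵀ) *ᵥ (fun p : ι × ι => W p.1 p.2) =
      hsInner W (D * W * Dᴴ) + hsInner W (Dᴴ * W * D) := by
  rw [add_mulVec, kronecker_mulVec_vec, kronecker_mulVec_vec, transpose_transpose,
    transpose_transpose, dotProduct_add, star_vec_dotProduct_vec, star_vec_dotProduct_vec]

omit [DecidableEq ι] in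
/-- **Hilbert–Schmidt Cauchy–Schwarz for the coupling.** If `‖Dᴴ v‖² ≤ M ‖v‖²` for all `v`,
`W` is Hermitian with `‖ψ_W‖ = 1`, and `κ ≤ Re ⟨ψ_W, (D ⊗ D̄ + Dᴴ ⊗ D̄ᴴ) ψ_W⟩` with `κ, M > 0`,
then the columns satisfy `Σ_t ‖D w_t‖² ≥ κ² / (4M)`
(`Re Tr (Wᴴ D W Dᴴ) ≤ ‖Dᴴ W‖_HS ‖W Dᴴ‖_HS`, `‖Dᴴ W‖²_HS ≤ M`, `‖W Dᴴ‖_HS = ‖D W‖_HS`). [folklore] -/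
theorem sum_cols_coupling_lower (D : Matrix ι ι ℂ) {W : Matrix ι ι ℂ} (hW : Wᴴ = W) {M κ : ℝ}
    (hM : 0 < M) (hκ : 0 < κ)
    (hDh : ∀ v : ι → ℂ, (star (Dᴴ *ᵥ v) ⬝ᵥ (Dᴴ *ᵥ v)).re ≤ M * (star v ⬝ᵥ v).re)
    (h1 : star (fun p : ι × ι => W p.1 p.2) ⬝ᵥ (fun p : ι × ι => W p.1 p.2) = 1)
    (hK : κ ≤ (star (fun p : ι × ι => W p.1 p.2) ⬝ᵥ
        (D ⊗ₖ Dᴴᵀ + Dᴴ ⊗ₖ Dᵀ) *ᵥ (fun p : ι × ι => W p.1 p.2)).re) :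
    κ ^ 2 / (4 * M) ≤ ∑ t, (star (D *ᵥ fun s => W s t) ⬝ᵥ (D *ᵥ fun s => W s t)).re := by
  -- the column sums
  set G : ℝ := ∑ t, (star (D *ᵥ fun s => W s t) ⬝ᵥ (D *ᵥ fun s => W s t)).re with hG
  have hp1 : ∑ t, (star (fun s => W s t) ⬝ᵥ fun s => W s t).re = 1 := by
    rw [← Complex.re_sum, ← star_vec_self_eq_sum_cols W, h1, Complex.one_re]
  have hDW : (hsInner (D * W) (D * W)).re = G := by
    rw [hsInner_mul_self_eq_sum_cols, Complex.re_sum]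
  have hDhW : (hsInner (Dᴴ * W) (Dᴴ * W)).re ≤ M := by
    rw [hsInner_mul_self_eq_sum_cols, Complex.re_sum]
    calc ∑ t, (star (Dᴴ *ᵥ fun s => W s t) ⬝ᵥ (Dᴴ *ᵥ fun s => W s t)).re
        ≤ ∑ t, M * (star (fun s => W s t) ⬝ᵥ fun s => W s t).re :=
          Finset.sum_le_sum fun t _ => hDh _
      _ = M := by rw [← Finset.mul_sum, hp1, mul_one]
  -- the two coupling terms
  rw [star_vec_coupling_mulVec_vec, Complex.add_re] at hK
  set l : ℝ := κ / (2 * M) with hl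
  have hl0 : 0 < l := div_pos hκ (by positivity)
  have hT1 : 2 * (hsInner W (D * W * Dᴴ)).re ≤ l * M + l⁻¹ * G := by
    rw [hsInner_conj_eq]
    refine (two_mul_re_hsInner_le (Dᴴ * W) (W * Dᴴ) hl0).trans ?_
    rw [hsInner_mul_conjTranspose_self hW, hDW]
    nlinarith [mul_le_mul_of_nonneg_left hDhW hl0.le]
  have hT2 : 2 * (hsInner W (Dᴴ * W * D)).re ≤ l⁻¹ * G + l * M := by
    have h := two_mul_re_hsInner_le (Dᴴᴴ * W) (W * Dᴴᴴ) (inv_pos.2 hl0)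
    rw [← hsInner_conj_eq, hsInner_mul_conjTranspose_self hW, inv_inv,
      conjTranspose_conjTranspose, hDW] at h
    nlinarith [mul_le_mul_of_nonneg_left hDhW hl0.le]
  -- `κ ≤ l M + l⁻¹ G` with `l = κ / (2M)`, i.e. `κ / 2 ≤ 2 M G / κ`
  have hκ' : κ ≤ l * M + l⁻¹ * G := by linarith
  have hlM : l * M = κ / 2 := by
    rw [hl]
    field_simp
  have hli : l⁻¹ = 2 * M / κ := by
    rw [hl, inv_div]
  rw [hlM, hli] at hκ'
  have h2 : κ / 2 ≤ 2 * M / κ * G := by linarith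
  rw [div_mul_eq_mul_div, le_div_iff₀ hκ] at h2
  rw [div_le_iff₀ (by positivity)]
  nlinarith

/-- **Abstract column pigeonhole on a Hermitian window matrix.** `A` Hermitian, `D` arbitrary on
a finite index type; two disjoint blocks `P₁, P₂`; `W = Wᴴ` supported on pairs in a common block
(`¬ good (s,t) → W s t = 0`, `good (s,t) → same block`), packaged as the two-layer unit vector
`ψ_W (s,t) = W s t`; `A ≥ e₀` on block-supported vectors; one-layer bounds
`‖D v‖², ‖Dᴴ v‖² ≤ M ‖v‖²`. If `Re ⟨ψ_W, (A ⊗ 1 + 1 ⊗ Aᵀ) ψ_W⟩ ≤ 2e₀ + η` and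
`κ ≤ Re ⟨ψ_W, (D ⊗ D̄ + Dᴴ ⊗ D̄ᴴ) ψ_W⟩` (`D̄ = Dᴴᵀ`), then some normalised block-supported vector
`v` (a column of `W`) has `Re ⟨v, A v⟩ ≤ e₀ + 8M²η/κ²` and `‖D v‖² ≥ κ²/(8M)`.
Columns `w_t` are block-supported, `Σ_t ‖w_t‖² = 1`, `Σ_t (Re ⟨w_t, A w_t⟩ - e₀ ‖w_t‖²) ≤ η/2`
(`re_star_vec_double_mulVec_vec`), `Σ_t ‖D w_t‖² ≥ κ²/(4M)` (`sum_cols_coupling_lower`), and the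
pigeonhole `exists_good_index`. Koma–Tasaki, J. Stat. Phys. 76 (1994) 745; Lieb, PRL 62 (1989)
1201. [folklore] -/
theorem windowPigeonhole (A D W : Matrix ι ι ℂ) (P₁ P₂ : ι → Prop)
    (good : ι × ι → Prop) (e₀ M η κ : ℝ)
    (_hA : A.IsHermitian) (hW : Wᴴ = W) (h12 : ∀ s, P₁ s → ¬ P₂ s)
    (hgood : ∀ s t, good (s, t) → (P₁ s ∧ P₁ t) ∨ (P₂ s ∧ P₂ t))
    (hWsupp : ∀ s t, ¬ good (s, t) → W s t = 0)
    (hM : 0 < M) (hη : 0 ≤ η) (hκ : 0 < κ)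
    (hA₁ : ∀ v : ι → ℂ, (∀ s, ¬ P₁ s → v s = 0) → e₀ * (star v ⬝ᵥ v).re ≤ (star v ⬝ᵥ A *ᵥ v).re)
    (hA₂ : ∀ v : ι → ℂ, (∀ s, ¬ P₂ s → v s = 0) → e₀ * (star v ⬝ᵥ v).re ≤ (star v ⬝ᵥ A *ᵥ v).re)
    (hD : ∀ v : ι → ℂ, (star (D *ᵥ v) ⬝ᵥ (D *ᵥ v)).re ≤ M * (star v ⬝ᵥ v).re)
    (hDh : ∀ v : ι → ℂ, (star (Dᴴ *ᵥ v) ⬝ᵥ (Dᴴ *ᵥ v)).re ≤ M * (star v ⬝ᵥ v).re)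
    (h1 : star (fun p : ι × ι => W p.1 p.2) ⬝ᵥ (fun p : ι × ι => W p.1 p.2) = 1)
    (hH0 : (star (fun p : ι × ι => W p.1 p.2) ⬝ᵥ
        (A ⊗ₖ (1 : Matrix ι ι ℂ) + (1 : Matrix ι ι ℂ) ⊗ₖ Aᵀ) *ᵥ (fun p : ι × ι => W p.1 p.2)).re ≤
      2 * e₀ + η)
    (hK : κ ≤ (star (fun p : ι × ι => W p.1 p.2) ⬝ᵥ
        (D ⊗ₖ Dᴴᵀ + Dᴴ ⊗ₖ Dᵀ) *ᵥ (fun p : ι × ι => W p.1 p.2)).re) :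
    ∃ v : ι → ℂ, ((∀ s, ¬ P₁ s → v s = 0) ∨ (∀ s, ¬ P₂ s → v s = 0)) ∧ star v ⬝ᵥ v = 1 ∧
      (star v ⬝ᵥ A *ᵥ v).re ≤ e₀ + 8 * M ^ 2 * η / κ ^ 2 ∧
      κ ^ 2 / (8 * M) ≤ (star (D *ᵥ v) ⬝ᵥ (D *ᵥ v)).re := by
  -- (a) every column is supported in one block (in `P₁` vacuously if it vanishes)
  have hcol : ∀ t, (∀ s, ¬ P₁ s → W s t = 0) ∨ (∀ s, ¬ P₂ s → W s t = 0) := by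
    intro t
    have hz : ∀ s, ¬ good (s, t) → W s t = 0 := fun s hs => hWsupp s t hs
    by_cases ht1 : P₁ t
    · refine Or.inl fun s hs => hz s fun hg => ?_
      rcases hgood s t hg with ⟨hs', -⟩ | ⟨-, ht'⟩
      · exact hs hs'
      · exact h12 t ht1 ht'
    · by_cases ht2 : P₂ t
      · refine Or.inr fun s hs => hz s fun hg => ?_
        rcases hgood s t hg with ⟨-, ht'⟩ | ⟨hs', -⟩
        · exact ht1 ht'
        · exact hs hs'
      · refine Or.inl fun s _ => hz s fun hg => ?_
        rcases hgood s t hg with ⟨-, ht'⟩ | ⟨-, ht'⟩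
        · exact ht1 ht'
        · exact ht2 ht'
  have hblock : ∀ t, e₀ * (star (fun s => W s t) ⬝ᵥ fun s => W s t).re ≤
      (star (fun s => W s t) ⬝ᵥ A *ᵥ fun s => W s t).re := by
    intro t
    rcases hcol t with h | h
    · exact hA₁ _ h
    · exact hA₂ _ h
  -- (b) the finite law `p_t = ‖w_t‖²`
  have hp0 : ∀ t, 0 ≤ (star (fun s => W s t) ⬝ᵥ fun s => W s t).re := fun t =>
    (Complex.nonneg_iff.1 (dotProduct_star_self_nonneg _)).1
  have hp1 : ∑ t, (star (fun s => W s t) ⬝ᵥ fun s => W s t).re = 1 := by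
    rw [← Complex.re_sum, ← star_vec_self_eq_sum_cols W, h1, Complex.one_re]
  -- (c) the excesses sum to at most `η / 2`
  have hexcs : ∑ t, ((star (fun s => W s t) ⬝ᵥ A *ᵥ fun s => W s t).re -
      e₀ * (star (fun s => W s t) ⬝ᵥ fun s => W s t).re) ≤ η / 2 := by
    rw [re_star_vec_double_mulVec_vec A hW] at hH0
    rw [Finset.sum_sub_distrib, ← Finset.mul_sum, hp1, mul_one]
    linarith
  -- (d) the coupling forces `Σ_t ‖D w_t‖² ≥ κ² / (4M)`
  have hGs := sum_cols_coupling_lower D hW hM hκ hDh h1 hK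
  -- (e) pigeonhole
  have hβ : 0 < κ ^ 2 / (4 * M) := by positivity
  obtain ⟨t, hpt, hgt, het⟩ := exists_good_index
    (fun t => (star (fun s => W s t) ⬝ᵥ fun s => W s t).re)
    (fun t => (star (D *ᵥ fun s => W s t) ⬝ᵥ (D *ᵥ fun s => W s t)).re)
    (fun t => (star (fun s => W s t) ⬝ᵥ A *ᵥ fun s => W s t).re -
      e₀ * (star (fun s => W s t) ⬝ᵥ fun s => W s t).re)
    hM hβ hη hp0 hp1 (fun t => hD _) hGs (fun t => sub_nonneg.2 (hblock t)) hexcs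
  -- normalise the column `t`
  set u : ι → ℂ := fun s => W s t with hu
  set q : ℝ := (star u ⬝ᵥ u).re with hq
  have hqc : star u ⬝ᵥ u = (q : ℂ) := by
    apply Complex.ext
    · rw [Complex.ofReal_re]
    · rw [Complex.ofReal_im]
      exact ((Complex.nonneg_iff.1 (dotProduct_star_self_nonneg u)).2).symm
  set c : ℝ := (Real.sqrt q)⁻¹ with hc
  have hc0 : 0 < c := inv_pos.2 (Real.sqrt_pos.2 hpt)
  have hcq : c * c * q = 1 := by
    rw [hc, ← mul_inv, Real.mul_self_sqrt hpt.le, inv_mul_cancel₀ hpt.ne']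
  have hsmul : ∀ x y : ι → ℂ, (star ((c : ℂ) • x) ⬝ᵥ ((c : ℂ) • y)).re = c * c * (star x ⬝ᵥ y).re := by
    intro x y
    rw [star_smul, smul_dotProduct, dotProduct_smul, smul_smul, Complex.star_def,
      Complex.conj_ofReal, smul_eq_mul, ← Complex.ofReal_mul, Complex.re_ofReal_mul]
  refine ⟨(c : ℂ) • u, ?_, ?_, ?_, ?_⟩
  · rcases hcol t with h | h
    · refine Or.inl fun s hs => ?_
      show (c : ℂ) • W s t = 0
      rw [h s hs, smul_zero]
    · refine Or.inr fun s hs => ?_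
      show (c : ℂ) • W s t = 0
      rw [h s hs, smul_zero]
  · rw [star_smul, smul_dotProduct, dotProduct_smul, smul_smul, hqc, Complex.star_def,
      Complex.conj_ofReal, smul_eq_mul]
    exact_mod_cast hcq
  · rw [mulVec_smul, hsmul]
    have hC : 2 * M * η / (κ ^ 2 / (4 * M)) = 8 * M ^ 2 * η / κ ^ 2 := by
      field_simp
      ring
    rw [hC] at het
    have h' : (star u ⬝ᵥ A *ᵥ u).re ≤ (e₀ + 8 * M ^ 2 * η / κ ^ 2) * q := by
      rw [hq]
      linarith
    calc c * c * (star u ⬝ᵥ A *ᵥ u).re ≤ c * c * ((e₀ + 8 * M ^ 2 * η / κ ^ 2) * q) :=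
          mul_le_mul_of_nonneg_left h' (mul_self_nonneg c)
      _ = e₀ + 8 * M ^ 2 * η / κ ^ 2 := by
          rw [mul_comm (e₀ + _) q, ← mul_assoc, hcq, one_mul]
  · rw [mulVec_smul, hsmul]
    have h' : κ ^ 2 / (8 * M) * q ≤ (star (D *ᵥ u) ⬝ᵥ (D *ᵥ u)).re := by
      rw [hq]
      have : κ ^ 2 / (8 * M) = κ ^ 2 / (4 * M) / 2 := by ring
      rw [this]
      exact hgt
    calc κ ^ 2 / (8 * M) = c * c * (κ ^ 2 / (8 * M) * q) := by
          rw [mul_comm (κ ^ 2 / (8 * M)) q, ← mul_assoc, hcq, one_mul]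
      _ ≤ c * c * (star (D *ᵥ u) ⬝ᵥ (D *ᵥ u)).re :=
          mul_le_mul_of_nonneg_left h' (mul_self_nonneg c)

end Abstract

end Summit.HubbardSuperconductivity.HubbardSuperconductivity.Theorems.JosephsonMirror
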